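import Summits.NavierStokesRegularity.NavierStokesRegularity.Theorems.AxisymmetricExtremalityAxisymmetricKatoGlobalStubSeregin2020TypeIILemma22InvCylRadius
import Mathlib.Analysis.MeanInequalities
import Mathlib.MeasureTheory.Integral.Prod
import HarnessLib

/-!
# Seregin 2020, Lemma 2.2 (after Nazarov–Uraltseva 2012): measure-theoretic tools for the
# measure estimate (4.6)–(4.8) — the drift and axis-drift integrals over sublevel/superlevel sets

Helper toward the stub `stub_seregin2020TypeII` of the crux `AxisymmetricKatoGlobal` (= the named
fact `Literature.Analysis.FluidPDE.Seregin2020_axisymmetricSingularPoint_typeII`, G. Seregin,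
Anal. Math. Phys. 10 (2020) Paper 46 = arXiv:2006.04140, Thm 2.1), reduced in the tree to the
corrected Lemma 2.2 (`hWH′`; Nazarov–Uraltseva 2012, Lemma 4.2 for the class 𝒱). In N–U's
(4.6)–(4.8) the integrals `∫∫_E V|v|` and `∫∫_E V/|x'|` over the superlevel set `E` are bounded
by Hölder (`v ∈ L_{3,4}`, `1/|x'| ∈ L_{9/5,∞}`) in terms of powers of `|E|`. This file provides
Hölder-free substitutes with the same scaling (truncation at a level instead of Hölder):

* `lintegral_cube_slab_le` — from the drift bound `∫_{-R²}^0 (∫_{B(2R)} ‖U‖³)^{4/3} ≤ N R²`: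
  `∫∫_{]-R²,-¾R²[ × B_R} ‖U‖³ ≤ ¾ N R² + R²/16` (Tonelli and Young `x ≤ ¾x^{4/3} + ¼`);
* `setIntegral_norm_le_of_cube` — `∫_A ‖U‖ ≤ L⁻² ∫_{Q'} ‖U‖³ + L |A|` for `A ⊆ Q'`
  (`u ≤ u³/L² + L`);
* `setIntegral_inv_cylRadius_le` — `∫_A ϱ⁻¹ ≤ ∫_{Q' ∩ {ϱ < ρ}} ϱ⁻¹ + ρ⁻¹ |A|`;
* `lintegral_inv_cylRadius_thin_le` — `∫_{B(0,R) ∩ {ϱ < θ²R}} ϱ⁻¹ ≤ θ C R²`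
  (`ϱ⁻¹ ≤ θ√R ϱ^{-3/2}` there and `∫_{B_R} ϱ^{-3/2} ≤ C R^{3/2}`,
  `lintegral_inv_cylRadius_rpow_ball_le`).

## References

* A. I. Nazarov, N. N. Uraltseva, St. Petersburg Math. J. 23 (2012) 93–115 = arXiv:1011.1888,
  proof of Lemma 4.2, (4.6)–(4.8). [NazarovUraltseva2012]
* G. Seregin, Anal. Math. Phys. 10 (2020), Paper 46 = arXiv:2006.04140, Lemma 2.2, (2.10).
  [Seregin2020]
-/

-- the problem directory repeats the summit name (D-0017); core's `dupNamespace` linter fires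
set_option linter.dupNamespace false

noncomputable section

open MeasureTheory Set Function Filter Topology TopologicalSpace Metric
open scoped NNReal ENNReal

namespace Summit.NavierStokesRegularity.NavierStokesRegularity.Theorems.AxisymmetricKatoGlobal.EulerScaling

open Literature.Analysis.FluidPDE

/-! ### The cube of the drift on the slab -/

/-- Young's inequality with exponents `4/3, 4` in `ℝ≥0∞`: `x ≤ ¾ x^{4/3} + ¼`. [folklore] -/
theorem ennreal_le_rpow_fourThirds_add (x : ℝ≥0∞) :
    x ≤ (3 / 4 : ℝ≥0∞) * x ^ (4 / 3 : ℝ) + (1 / 4 : ℝ≥0∞) := by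
  have hpq : (4 / 3 : ℝ).HolderConjugate 4 := by
    rw [Real.holderConjugate_iff]; norm_num
  have h := ENNReal.young_inequality x 1 hpq
  rw [mul_one, ENNReal.one_rpow] at h
  have e1 : ENNReal.ofReal (4 / 3 : ℝ) = 4 / 3 := by
    rw [ENNReal.ofReal_div_of_pos (by norm_num)]; simp
  have e2 : ENNReal.ofReal (4 : ℝ) = 4 := by simp
  have e3 : x ^ (4 / 3 : ℝ) / ENNReal.ofReal (4 / 3 : ℝ) = (3 / 4 : ℝ≥0∞) * x ^ (4 / 3 : ℝ) := by
    rw [e1, div_eq_mul_inv, ENNReal.inv_div (Or.inl (by simp)) (Or.inl (by simp)), mul_comm]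
  have e4 : (1 : ℝ≥0∞) / ENNReal.ofReal (4 : ℝ) = 1 / 4 := by rw [e2]
  rw [e3, e4] at h
  exact h

/-- **The cube of the drift on the slab `]-R², -¾R²[ × B_R`** is controlled by the scale-invariant
drift bound of `hWH′`: `∫∫ ‖U‖³ ≤ ¾ N R² + R²/16`. [cite: NazarovUraltseva2012, Lemma 4.2, the quantity 𝒩̂ = R^{-α}‖v‖_{q,ℓ}] -/
theorem lintegral_cube_slab_le {R : ℝ} (hR : 0 < R) {N : ℝ≥0}
    {U : ℝ → EuclideanSpace ℝ (Fin 3) → EuclideanSpace ℝ (Fin 3)}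
    (hUm : AEStronglyMeasurable (uncurry U)
      (volume.restrict (Ioo (-R ^ 2) (-(3 / 4) * R ^ 2) ×ˢ ball (0 : EuclideanSpace ℝ (Fin 3)) R)))
    (hN : ∫⁻ s in Ioo (-R ^ 2) 0, (∫⁻ y in ball (0 : EuclideanSpace ℝ (Fin 3)) (2 * R), ‖U s y‖ₑ ^ (3 : ℕ)) ^ (4 / 3 : ℝ) ≤
      (N : ℝ≥0∞) * ENNReal.ofReal R ^ 2) :
    ∫⁻ z in Ioo (-R ^ 2) (-(3 / 4) * R ^ 2) ×ˢ ball (0 : EuclideanSpace ℝ (Fin 3)) R, ‖U z.1 z.2‖ₑ ^ (3 : ℕ) ≤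
      (3 / 4 : ℝ≥0∞) * ((N : ℝ≥0∞) * ENNReal.ofReal R ^ 2) + ENNReal.ofReal (R ^ 2 / 16) := by
  set I : Set ℝ := Ioo (-R ^ 2) (-(3 / 4) * R ^ 2) with hI
  set B : Set (EuclideanSpace ℝ (Fin 3)) := ball 0 R with hB
  have hIm : MeasurableSet I := measurableSet_Ioo
  have hf : AEMeasurable (fun z : ℝ × EuclideanSpace ℝ (Fin 3) => ‖U z.1 z.2‖ₑ ^ (3 : ℕ))
      ((volume.prod volume).restrict (I ×ˢ B)) := by
    have h : AEMeasurable (fun z : ℝ × EuclideanSpace ℝ (Fin 3) => ‖uncurry U z‖ₑ ^ (3 : ℕ))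
        (volume.restrict (I ×ˢ B)) := hUm.enorm.pow_const 3
    rw [← Measure.volume_eq_prod]; exact h
  rw [Measure.volume_eq_prod, setLIntegral_prod _ hf]
  -- slice bound by Young and monotonicity in the domain
  have hslice : ∀ s, ∫⁻ y in B, ‖U s y‖ₑ ^ (3 : ℕ) ≤
      (3 / 4 : ℝ≥0∞) * (∫⁻ y in ball (0 : EuclideanSpace ℝ (Fin 3)) (2 * R), ‖U s y‖ₑ ^ (3 : ℕ)) ^ (4 / 3 : ℝ) + 1 / 4 := by
    intro s
    have hmono : ∫⁻ y in B, ‖U s y‖ₑ ^ (3 : ℕ) ≤ ∫⁻ y in ball (0 : EuclideanSpace ℝ (Fin 3)) (2 * R), ‖U s y‖ₑ ^ (3 : ℕ) :=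
      lintegral_mono_set (ball_subset_ball (by linarith))
    have hp : (∫⁻ y in B, ‖U s y‖ₑ ^ (3 : ℕ)) ^ (4 / 3 : ℝ) ≤
        (∫⁻ y in ball (0 : EuclideanSpace ℝ (Fin 3)) (2 * R), ‖U s y‖ₑ ^ (3 : ℕ)) ^ (4 / 3 : ℝ) :=
      ENNReal.rpow_le_rpow hmono (by norm_num)
    calc ∫⁻ y in B, ‖U s y‖ₑ ^ (3 : ℕ) ≤ (3 / 4 : ℝ≥0∞) * (∫⁻ y in B, ‖U s y‖ₑ ^ (3 : ℕ)) ^ (4 / 3 : ℝ) + 1 / 4 :=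
          ennreal_le_rpow_fourThirds_add _
      _ ≤ _ := by gcongr
  refine (lintegral_mono fun s => hslice s).trans ?_
  rw [lintegral_add_right _ measurable_const, lintegral_const_mul' _ _ (by finiteness), lintegral_const,
    Measure.restrict_apply_univ, Real.volume_Ioo]
  have hmono : ∫⁻ s in I, (∫⁻ y in ball (0 : EuclideanSpace ℝ (Fin 3)) (2 * R), ‖U s y‖ₑ ^ (3 : ℕ)) ^ (4 / 3 : ℝ) ≤
      (N : ℝ≥0∞) * ENNReal.ofReal R ^ 2 :=
    (lintegral_mono_set (Ioo_subset_Ioo le_rfl (by nlinarith))).trans hN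
  have e : (1 / 4 : ℝ≥0∞) * ENNReal.ofReal (-(3 / 4) * R ^ 2 - -R ^ 2) = ENNReal.ofReal (R ^ 2 / 16) := by
    rw [show (1 / 4 : ℝ≥0∞) = ENNReal.ofReal (1 / 4) by
      rw [ENNReal.ofReal_div_of_pos (by norm_num)]; simp, ← ENNReal.ofReal_mul (by norm_num)]
    congr 1; ring
  rw [e]
  gcongr

/-! ### Truncation substitutes for Hölder -/

/-- `u ≤ u³/L² + L` for `u ≥ 0`, `L > 0`. [folklore] -/
theorem le_cube_div_sq_add {u L : ℝ} (hu : 0 ≤ u) (hL : 0 < L) : u ≤ u ^ 3 / L ^ 2 + L := by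
  rcases le_or_gt L u with h | h
  · have h1 : L ^ 2 ≤ u ^ 2 := pow_le_pow_left₀ hL.le h 2
    have : u ≤ u ^ 3 / L ^ 2 := by
      rw [le_div_iff₀ (by positivity)]
      nlinarith [mul_le_mul_of_nonneg_left h1 hu]
    linarith
  · have : 0 ≤ u ^ 3 / L ^ 2 := by positivity
    linarith

/-- **Drift integral over a subset**: `∫_A ‖U‖ ≤ L⁻² ∫_{Q} ‖U‖³ + L·|A|` for measurable
`A ⊆ Q` of finite measure and `‖U‖³ ∈ L¹(Q)`. [cite: NazarovUraltseva2012, proof of Lemma 4.2, the term ‖1‖_{q',ℓ',Ê} of (4.7)] -/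
theorem setIntegral_norm_le_of_cube {Q A : Set (ℝ × EuclideanSpace ℝ (Fin 3))}
    (hAQ : A ⊆ Q) (hAfin : volume A < ∞)
    {U : ℝ → EuclideanSpace ℝ (Fin 3) → EuclideanSpace ℝ (Fin 3)}
    (hU3 : IntegrableOn (fun z : ℝ × EuclideanSpace ℝ (Fin 3) => ‖U z.1 z.2‖ ^ 3) Q) {L : ℝ} (hL : 0 < L) :
    ∫ z in A, ‖U z.1 z.2‖ ≤ L⁻¹ ^ 2 * (∫ z in Q, ‖U z.1 z.2‖ ^ 3) + L * volume.real A := by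
  have hU3A : IntegrableOn (fun z : ℝ × EuclideanSpace ℝ (Fin 3) => ‖U z.1 z.2‖ ^ 3) A := hU3.mono_set hAQ
  have hgi : IntegrableOn (fun z : ℝ × EuclideanSpace ℝ (Fin 3) => ‖U z.1 z.2‖ ^ 3 / L ^ 2 + L) A :=
    (hU3A.div_const _).add (integrableOn_const (C := L) hAfin.ne)
  have hle : ∀ z : ℝ × EuclideanSpace ℝ (Fin 3), ‖U z.1 z.2‖ ≤ ‖U z.1 z.2‖ ^ 3 / L ^ 2 + L := fun z =>
    le_cube_div_sq_add (norm_nonneg _) hL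
  refine (integral_mono_of_nonneg (Eventually.of_forall fun z => norm_nonneg _) hgi
    (Eventually.of_forall hle)).trans ?_
  rw [integral_add (hU3A.div_const _) (integrableOn_const (C := L) hAfin.ne), integral_div,
    setIntegral_const, smul_eq_mul, mul_comm (volume.real A) L]
  refine add_le_add ?_ le_rfl
  rw [div_eq_mul_inv, mul_comm, inv_pow]
  exact mul_le_mul_of_nonneg_left (setIntegral_mono_set hU3 (Eventually.of_forall fun z => by positivity)
    (Eventually.of_forall hAQ)) (by positivity)

/-- **Axis-drift integral over a subset**: `∫_A ϱ⁻¹ ≤ ∫_{Q ∩ {ϱ < ρ}} ϱ⁻¹ + ρ⁻¹·|A|` for measurable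
`A ⊆ Q` of finite measure and `ϱ⁻¹ ∈ L¹(Q)`. [cite: NazarovUraltseva2012, proof of Lemma 4.2, the term ‖1‖_{9/4,1,Ê} of (4.7)] -/
theorem setIntegral_inv_cylRadius_le {Q A : Set (ℝ × EuclideanSpace ℝ (Fin 3))} (hQm : MeasurableSet Q)
    (hAm : MeasurableSet A) (hAQ : A ⊆ Q) (hAfin : volume A < ∞)
    (hρ : IntegrableOn (fun z : ℝ × EuclideanSpace ℝ (Fin 3) => (cylRadius z.2)⁻¹) Q) {ρ : ℝ} (hρ0 : 0 < ρ) :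
    ∫ z in A, (cylRadius z.2)⁻¹ ≤
      (∫ z in Q ∩ {z | cylRadius z.2 < ρ}, (cylRadius z.2)⁻¹) + ρ⁻¹ * volume.real A := by
  have hTm : MeasurableSet {z : ℝ × EuclideanSpace ℝ (Fin 3) | cylRadius z.2 < ρ} :=
    measurableSet_lt (continuous_cylRadius.comp continuous_snd).measurable measurable_const
  set g : ℝ × EuclideanSpace ℝ (Fin 3) → ℝ :=
    fun z => (Q ∩ {z | cylRadius z.2 < ρ}).indicator (fun z => (cylRadius z.2)⁻¹) z + ρ⁻¹ with hg
  have hgi : IntegrableOn g A := by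
    refine IntegrableOn.add ?_ (integrableOn_const (C := ρ⁻¹) hAfin.ne)
    exact ((hρ.mono_set inter_subset_left).integrable_indicator (hQm.inter hTm)).integrableOn
  have hle : ∀ z ∈ A, (cylRadius z.2)⁻¹ ≤ g z := by
    intro z hz
    rw [hg]
    by_cases h : cylRadius z.2 < ρ
    · simp only [indicator_of_mem (show z ∈ Q ∩ {z | cylRadius z.2 < ρ} from ⟨hAQ hz, h⟩)]
      linarith [inv_nonneg.2 hρ0.le]
    · have h' : (cylRadius z.2)⁻¹ ≤ ρ⁻¹ := by
        rw [not_lt] at h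
        exact inv_anti₀ hρ0 h
      linarith [indicator_nonneg (fun w _ => inv_nonneg.2 (cylRadius_nonneg w.2)) z
        (s := Q ∩ {z | cylRadius z.2 < ρ}) (f := fun z : ℝ × EuclideanSpace ℝ (Fin 3) => (cylRadius z.2)⁻¹)]
  refine (setIntegral_mono_on (hρ.mono_set hAQ) hgi hAm hle).trans ?_
  rw [hg, integral_add (((hρ.mono_set inter_subset_left).integrable_indicator (hQm.inter hTm)).integrableOn)
    (integrableOn_const (C := ρ⁻¹) hAfin.ne), setIntegral_const, smul_eq_mul, mul_comm (volume.real A)]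
  refine add_le_add ?_ le_rfl
  rw [integral_indicator (hQm.inter hTm), Measure.restrict_restrict (hQm.inter hTm)]
  refine setIntegral_mono_set (hρ.mono_set inter_subset_left) (Eventually.of_forall fun z => inv_nonneg.2 (cylRadius_nonneg _)) ?_
  exact Eventually.of_forall inter_subset_left

/-- **The axis drift near the axis**: `∫_{B(x₀,R) ∩ {ϱ < θ²R}} ϱ⁻¹ ≤ C θ R²` with the constant of
`lintegral_inv_cylRadius_rpow_ball_le` for `q = 3/2` (`ϱ⁻¹ = ϱ^{1/2} ϱ^{-3/2} ≤ θ√R·ϱ^{-3/2}` on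
the thin set, and `∫_{B_R} ϱ^{-3/2} ≤ C R^{3/2}`). [cite: NazarovUraltseva2012, §4, 1/|x'| ∈ L_{9/5,∞}] -/
theorem lintegral_inv_cylRadius_thin_le {C : ℝ≥0}
    (hC : ∀ (x₀ : EuclideanSpace ℝ (Fin 3)) (r : ℝ), 0 < r →
      ∫⁻ x in ball x₀ r, ENNReal.ofReal (cylRadius x ^ (-(3 / 2 : ℝ))) ≤ (C : ℝ≥0∞) * ENNReal.ofReal (r ^ (3 - 3 / 2 : ℝ)))
    {R θ : ℝ} (hR : 0 < R) (hθ : 0 < θ) (x₀ : EuclideanSpace ℝ (Fin 3)) :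
    ∫⁻ x in ball x₀ R ∩ {x | cylRadius x < θ ^ 2 * R}, ENNReal.ofReal ((cylRadius x)⁻¹) ≤
      ENNReal.ofReal (C * θ * R ^ 2) := by
  have hpt : ∀ x ∈ ball x₀ R ∩ {x : EuclideanSpace ℝ (Fin 3) | cylRadius x < θ ^ 2 * R},
      ENNReal.ofReal ((cylRadius x)⁻¹) ≤ ENNReal.ofReal (θ * Real.sqrt R) * ENNReal.ofReal (cylRadius x ^ (-(3 / 2 : ℝ))) := by
    rintro x ⟨-, hx⟩
    rw [← ENNReal.ofReal_mul (by positivity)]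
    refine ENNReal.ofReal_le_ofReal ?_
    rcases (cylRadius_nonneg x).eq_or_lt with h0 | hpos
    · rw [← h0]; simp
    · -- `ϱ⁻¹ = ϱ^{1/2} · ϱ^{-3/2} ≤ θ√R · ϱ^{-3/2}`
      have e : (cylRadius x)⁻¹ = cylRadius x ^ (1 / 2 : ℝ) * cylRadius x ^ (-(3 / 2 : ℝ)) := by
        rw [← Real.rpow_add hpos, ← Real.rpow_neg_one]; norm_num
      rw [e]
      refine mul_le_mul_of_nonneg_right ?_ (Real.rpow_nonneg (cylRadius_nonneg x) _)
      rw [← Real.sqrt_eq_rpow]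
      calc Real.sqrt (cylRadius x) ≤ Real.sqrt (θ ^ 2 * R) := Real.sqrt_le_sqrt (le_of_lt (mem_setOf.1 hx))
        _ = θ * Real.sqrt R := by rw [Real.sqrt_mul (sq_nonneg θ), Real.sqrt_sq hθ.le]
  have hm : MeasurableSet (ball x₀ R ∩ {x : EuclideanSpace ℝ (Fin 3) | cylRadius x < θ ^ 2 * R}) :=
    measurableSet_ball.inter (measurableSet_lt continuous_cylRadius.measurable measurable_const)
  refine (setLIntegral_mono' hm hpt).trans ?_
  rw [lintegral_const_mul' _ _ ENNReal.ofReal_ne_top]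
  refine (mul_le_mul' le_rfl ((lintegral_mono_set inter_subset_left).trans (hC x₀ R hR))).trans ?_
  rw [← ENNReal.ofReal_coe_nnreal, ← ENNReal.ofReal_mul (NNReal.coe_nonneg C), ← ENNReal.ofReal_mul (by positivity)]
  refine ENNReal.ofReal_le_ofReal (le_of_eq ?_)
  have e3 : R ^ (3 - 3 / 2 : ℝ) = R * Real.sqrt R := by
    rw [show (3 - 3 / 2 : ℝ) = 1 + 1 / 2 by norm_num, Real.rpow_add hR, Real.rpow_one, Real.sqrt_eq_rpow]
  rw [e3]
  have hs : Real.sqrt R * Real.sqrt R = R := Real.mul_self_sqrt hR.le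
  calc θ * Real.sqrt R * (C * (R * Real.sqrt R)) = C * θ * R * (Real.sqrt R * Real.sqrt R) := by ring
    _ = C * θ * R ^ 2 := by rw [hs]; ring

end Summit.NavierStokesRegularity.NavierStokesRegularity.Theorems.AxisymmetricKatoGlobal.EulerScaling

end
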